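import Summits.BirchSwinnertonDyer.BirchSwinnertonDyer.Theorems.SignedLowerHalvesSmallImageLowerHalfBothSignsRttRecipMTOfValuesMT
import Literature.NumberTheory.EllipticCurves.PadicCoeffIntegersFrobeniusData
import HarnessLib

/-!
# Route `SignedLowerHalves`, crux L `SmallImageLowerHalfBothSigns` (stmt-BirchSwinnertonDyer-23599), line `rtt_w3` v42 — row S4″/S4‴, brick β7 (ASSEMBLY), LEAD g15, part 4:
# CONSTANTS IN `ℚ̄_p` — the identity principle over a FINITE coefficient enlargement `S ∪ (range ι ∪ T)` (RULING «(α)», -w3 g29's residue (R-α))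

The value identities of S4‴ compare the Mazur–Tate side (transported plus period `Ω′` of `g^{e∘ι}`, honda g30) with the Coleman side (Kato's CM period inside `C_K`, F1); the ratio of the
two constants is a `p`-adic number whose membership in `ℚ_p(S ∪ ι K_g)` would need a CM period relation (Shimura 1977 / Kato §15.11) — a print input the line does not want. It is not
needed: every element of `ℚ̄_p = AlgebraicClosure ℚ_p` is algebraic, so for constants `c, d ∈ ℚ̄_pˣ` the coefficient field `ℚ_p(S ∪ ι K_g ∪ {c, d})` is still finite over `ℚ_p`, the
identity principle of parts 1–3 runs there after scaling `c, d` into its ring of integers by a power of `p`, and downstream only the ratio `d/c ∈ ℚ̄_pˣ` is consumed (`CharRoadReciprocity`).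
* `finiteDimensional_padicCoeffField_of_finite`, `finiteDimensional_padicCoeffField_union`, `finiteDimensional_padicCoeffField_union_range_union` — finiteness bookkeeping;
* ★★★ `exists_isCongrModOmegaO_mazurTateElementK_of_primitive_values_alg` — part 3 with `c d : PadicAlgCl p` (non-zero) in `hval`, concluding
  `∃ T finite, ∃ c′ d′ ∈ 𝒪_{S ∪ (range ι ∪ T)} ∖ 0, ∀ n of parity ε, d′·θ_n(g;Ω)^ι ≡ (−1)^{n/2+1}ω_n^∓·(c′·ι_S(U⁻¹·Y₀)) (mod ω_n)` over `S ∪ (range ι ∪ T)` — the v42 matrix of `CharRoadRecipMT`.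
THEOREMS ONLY (`--supports stmt-BirchSwinnertonDyer-23599` helper); closes nothing; S4‴, crux L and BSD remain OPEN, proved for NO curve.
References: [Kobayashi2003] Thm. 6.3; [Pollack2003] §6.5 Prop. 6.18; [PollackWeston2011MT] Rem. 2.2.
-/

set_option autoImplicit false
-- the Theorems namespace of this sub repeats the summit name by design (D-0017 nested layout)
set_option linter.dupNamespace false

noncomputable section

open scoped MatrixGroups ModularForm
open Polynomial CongruenceSubgroup
open Literature.NumberTheory.EllipticCurves Literature.NumberTheory.EllipticCurves.ModularForms
open Summit.BirchSwinnertonDyer.BirchSwinnertonDyer.Theorems.ThetaTransport.MazurTateValuesRelay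

namespace Summit.BirchSwinnertonDyer.BirchSwinnertonDyer.Theorems.SmallImageRttReciprocity

variable {p : ℕ} [hp : Fact p.Prime]

/-! ## §1 Finiteness of the coefficient fields -/

/-- `ℚ_p(T)/ℚ_p` is finite for a FINITE set `T ⊆ ℚ̄_p` (every element of `ℚ̄_p` is algebraic). [folklore] -/
theorem finiteDimensional_padicCoeffField_of_finite (T : Set (PadicAlgCl p)) (hT : T.Finite) : FiniteDimensional ℚ_[p] (padicCoeffField T) := by
  haveI : Finite T := hT.to_subtype
  change FiniteDimensional ℚ_[p] (IntermediateField.adjoin ℚ_[p] T)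
  exact IntermediateField.finiteDimensional_adjoin fun x _ ↦ Algebra.IsIntegral.isIntegral x

/-- `ℚ_p(S ∪ T) = ℚ_p(S)·ℚ_p(T)` is finite when both factors are. [folklore] -/
theorem finiteDimensional_padicCoeffField_union (S T : Set (PadicAlgCl p)) [FiniteDimensional ℚ_[p] (padicCoeffField S)] [FiniteDimensional ℚ_[p] (padicCoeffField T)] :
    FiniteDimensional ℚ_[p] (padicCoeffField (S ∪ T)) := by
  rw [show padicCoeffField (S ∪ T) = padicCoeffField S ⊔ padicCoeffField T from IntermediateField.adjoin_union ℚ_[p]]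
  infer_instance

/-- The coefficient field of the v42 reciprocity row, `ℚ_p(S ∪ (ι K_g ∪ T))` with `T` finite, is finite over `ℚ_p` (`K_g` a number field). [folklore] -/
theorem finiteDimensional_padicCoeffField_union_range_union (S : Set (PadicAlgCl p)) [FiniteDimensional ℚ_[p] (padicCoeffField S)]
    {M : ℕ} {g : CuspForm (Gamma0 M) 2} (ι : coeffField g →+* PadicAlgCl p) [FiniteDimensional ℚ (coeffField g)] (T : Set (PadicAlgCl p)) (hT : T.Finite) :
    FiniteDimensional ℚ_[p] (padicCoeffField (S ∪ (Set.range ι ∪ T))) := by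
  haveI : FiniteDimensional ℚ_[p] (padicCoeffField (Set.range ι)) := GreenbergSelmer.finiteDimensional_padicCoeffField ι
  haveI := finiteDimensional_padicCoeffField_of_finite T hT
  haveI := finiteDimensional_padicCoeffField_union (Set.range (ι : coeffField g → PadicAlgCl p)) T
  exact finiteDimensional_padicCoeffField_union S _

/-! ## §2 The paste-ready form with constants in `ℚ̄_p` -/

variable {M : ℕ} {g : CuspForm (Gamma0 M) 2} {ι : coeffField g →+* PadicAlgCl p} {Ω : ℂ}

/-- ★★★ **S4″ FROM VALUES AT PRIMITIVE CHARACTERS, CONSTANTS IN `ℚ̄_p`** (RULING «(α)»). As `exists_isCongrModOmegaO_mazurTateElementK_of_primitive_values` (part 3), but the constants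
`c, d` of the value identities are bare non-zero `p`-adic numbers; the conclusion holds over the finite coefficient enlargement `S ∪ (range ι ∪ T)`, `T = {c, d}`, with integral constants
`c′ = p^m·c·a`, `d′ = p^m·d`. [cite: Kobayashi2003, Thm. 6.3] [cite: Pollack2003, §6.5 Prop. 6.18] [cite: PollackWeston2011MT, Rem. 2.2] -/
theorem exists_isCongrModOmegaO_mazurTateElementK_of_primitive_values_alg (S : Set (PadicAlgCl p)) [FiniteDimensional ℚ_[p] (padicCoeffField S)]
    [FiniteDimensional ℚ (coeffField g)]
    (hΩ : IsCohomologicalPlusPeriod g ι Ω) (ε : ℤˣ) (L : IwasawaAlgebraO (Set.range ι))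
    (hcongr : ∀ n : ℕ, (Even n ↔ ε = 1) → IsCongrModOmegaO (Set.range ι) n ((mazurTateElementK g Ω p n).map ι)
      (((((-1) ^ (n / 2 + 1) * (if ε = 1 then cyclotomicOmegaMinus p n else cyclotomicOmegaPlus p n)).map (Int.castRingHom (PadicAlgCl p)) :
          (PadicAlgCl p)[X]) : PowerSeries (PadicAlgCl p)) * iwasawaOToPowerSeries (Set.range ι) L))
    (Y₀ : IwasawaAlgebraO S) (a : padicCoeffIntegers S) (ha : a ≠ 0) (ev : ℕ → ℕ → padicCoeffIntegers S)
    (hread : ∀ n : ℕ,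
      (((if ε = 1 then cyclotomicOmegaMinus p n else cyclotomicOmegaPlus p n).map (Int.castRingHom (padicCoeffIntegers S)) :
          (padicCoeffIntegers S)[X]) : IwasawaAlgebraO S) * (PowerSeries.C a * Y₀) -
          ∑ i ∈ Finset.range (p ^ n), PowerSeries.C (ev n i) * (1 + PowerSeries.X : IwasawaAlgebraO S) ^ (p ^ n - i) ∈
        Ideal.span {(1 + PowerSeries.X : IwasawaAlgebraO S) ^ p ^ n - 1})
    (U : (IwasawaAlgebraO S)ˣ) (u : ℕ → (padicCoeffIntegers S)[X])
    (hu : ∀ n : ℕ, (U : IwasawaAlgebraO S) - (u n : IwasawaAlgebraO S) ∈ Ideal.span {(1 + PowerSeries.X : IwasawaAlgebraO S) ^ p ^ n - 1})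
    (c d : PadicAlgCl p) (hc : c ≠ 0) (hd : d ≠ 0) (n₀ : ℕ)
    (hval : ∀ n : ℕ, n₀ ≤ n → (Even n ↔ ε = 1) → ∀ ζ : PadicAlgCl p, IsPrimitiveRoot ζ (p ^ n) →
      d * ((u n).map (padicCoeffIntegers S).subtype).eval (ζ - 1) * ((mazurTateElementK g Ω p n).map ι).eval (ζ - 1) =
        (-1) ^ (n / 2 + 1) * c * ∑ i ∈ Finset.range (p ^ n), (ev n i : PadicAlgCl p) * ζ ^ (p ^ n - i)) :
    ∃ (T : Set (PadicAlgCl p)), T.Finite ∧ ∃ (c' d' : padicCoeffIntegers (S ∪ (Set.range ι ∪ T))), c' ≠ 0 ∧ d' ≠ 0 ∧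
      ∀ n : ℕ, (Even n ↔ ε = 1) → IsCongrModOmegaO (S ∪ (Set.range ι ∪ T)) n (Polynomial.C ((d' : PadicAlgCl p)) * (mazurTateElementK g Ω p n).map ι)
        (((((-1) ^ (n / 2 + 1) * (if ε = 1 then cyclotomicOmegaMinus p n else cyclotomicOmegaPlus p n)).map (Int.castRingHom (PadicAlgCl p)) : (PadicAlgCl p)[X]) :
            PowerSeries (PadicAlgCl p)) *
          (PowerSeries.C ((c' : PadicAlgCl p)) * iwasawaOToPowerSeries S (↑U⁻¹ * Y₀))) := by
  -- the finite enlargement `T = {c, d}` and its coefficient field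
  refine ⟨{c, d}, (Set.finite_singleton d).insert c, ?_⟩
  set T₂ : Set (PadicAlgCl p) := Set.range ι ∪ {c, d} with hT₂
  haveI : FiniteDimensional ℚ_[p] (padicCoeffField (S ∪ T₂)) :=
    finiteDimensional_padicCoeffField_union_range_union S ι {c, d} ((Set.finite_singleton d).insert c)
  have hιT₂ : Set.range ι ⊆ T₂ := Set.subset_union_left
  have hS : S ⊆ S ∪ T₂ := Set.subset_union_left
  -- `c, d` lie in the field; scale them into its integers
  have hcF : c ∈ padicCoeffField (S ∪ T₂) := IntermediateField.subset_adjoin ℚ_[p] _ (Or.inr (Or.inr (Set.mem_insert c {d})))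
  have hdF : d ∈ padicCoeffField (S ∪ T₂) := IntermediateField.subset_adjoin ℚ_[p] _ (Or.inr (Or.inr (Set.mem_insert_of_mem c rfl)))
  obtain ⟨m₁, hm₁⟩ := exists_natCast_pow_mul_mem_padicCoeffIntegers (S := S ∪ T₂) hcF
  obtain ⟨m₂, hm₂⟩ := exists_natCast_pow_mul_mem_padicCoeffIntegers (S := S ∪ T₂) hdF
  have hpO : (p : PadicAlgCl p) ∈ padicCoeffIntegers (S ∪ T₂) := by
    have h := natCast_mem (padicCoeffIntegers (S ∪ T₂)) p
    exact h
  have hcO : (p : PadicAlgCl p) ^ (m₁ + m₂) * c ∈ padicCoeffIntegers (S ∪ T₂) := by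
    rw [pow_add, mul_comm ((p : PadicAlgCl p) ^ m₁), mul_assoc]; exact mul_mem (pow_mem hpO m₂) hm₁
  have hdO : (p : PadicAlgCl p) ^ (m₁ + m₂) * d ∈ padicCoeffIntegers (S ∪ T₂) := by
    rw [pow_add, mul_assoc]; exact mul_mem (pow_mem hpO m₁) hm₂
  obtain ⟨c₁, hc₁⟩ : ∃ c₁ : padicCoeffIntegers (S ∪ T₂), (c₁ : PadicAlgCl p) = (p : PadicAlgCl p) ^ (m₁ + m₂) * c := ⟨⟨_, hcO⟩, rfl⟩
  obtain ⟨d₁, hd₁⟩ : ∃ d₁ : padicCoeffIntegers (S ∪ T₂), (d₁ : PadicAlgCl p) = (p : PadicAlgCl p) ^ (m₁ + m₂) * d := ⟨⟨_, hdO⟩, rfl⟩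
  have hpm : ((p : PadicAlgCl p) ^ (m₁ + m₂)) ≠ 0 := pow_ne_zero _ (Nat.cast_ne_zero.mpr hp.out.ne_zero)
  have hc₁0 : c₁ ≠ 0 := by
    intro h0; apply mul_ne_zero hpm hc; rw [← hc₁, h0, Subring.coe_zero]
  have hd₁0 : d₁ ≠ 0 := by
    intro h0; apply mul_ne_zero hpm hd; rw [← hd₁, h0, Subring.coe_zero]
  -- integral lifts of the Mazur–Tate elements over `𝒪_{T₂}`, and `L` moved to `𝒪_{T₂}⟦T⟧`
  choose Θ hΘ using exists_padicCoeffIntegers_map_eq_mazurTateElementK (p := p) hΩ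
  have hΘ₂ : ∀ n, ((Θ n).map (Subring.inclusion (padicCoeffIntegers_mono hιT₂))).map (padicCoeffIntegers T₂).subtype = (mazurTateElementK g Ω p n).map ι := fun n ↦ by
    rw [← hΘ n, Polynomial.map_map]
    ext k
    simp only [Polynomial.coeff_map, RingHom.coe_comp, Function.comp_apply, Subring.coe_subtype]
    exact Subring.coe_inclusion _ _
  set L₂ : IwasawaAlgebraO T₂ := (PowerSeries.map (Subring.inclusion (padicCoeffIntegers_mono hιT₂))) L with hL₂
  have hcongr₂ : ∀ n : ℕ, (Even n ↔ ε = 1) → IsCongrModOmegaO T₂ n ((mazurTateElementK g Ω p n).map ι)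
      (((((-1) ^ (n / 2 + 1) * (if ε = 1 then cyclotomicOmegaMinus p n else cyclotomicOmegaPlus p n)).map (Int.castRingHom (PadicAlgCl p)) :
          (PadicAlgCl p)[X]) : PowerSeries (PadicAlgCl p)) * iwasawaOToPowerSeries T₂ L₂) := fun n hn ↦ by
    rw [hL₂, iwasawaOToPowerSeries_inclΛ hιT₂]
    exact IsCongrModOmegaO.of_subset hιT₂ (hcongr n hn)
  -- the scaled value identities with the integral constants `c₁ = p^m c`, `d₁ = p^m d`
  have hval₁ : ∃ n₀' : ℕ, ∀ n : ℕ, n₀' ≤ n → (Even n ↔ ε = 1) → ∀ ζ : PadicAlgCl p, IsPrimitiveRoot ζ (p ^ n) →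
      (d₁ : PadicAlgCl p) * ((u n).map (padicCoeffIntegers S).subtype).eval (ζ - 1) * ((fun n ↦ (mazurTateElementK g Ω p n).map ι) n).eval (ζ - 1) =
        (-1) ^ (n / 2 + 1) * (c₁ : PadicAlgCl p) * ∑ i ∈ Finset.range (p ^ n), (ev n i : PadicAlgCl p) * ζ ^ (p ^ n - i) := by
    refine ⟨n₀, fun n hn hpar ζ hζ ↦ ?_⟩
    have h := hval n hn hpar ζ hζ
    rw [hc₁, hd₁]
    linear_combination ((p : PadicAlgCl p) ^ (m₁ + m₂)) * h
  have key := isCongrModOmegaO_of_primitive_values S T₂ ε (fun n ↦ (mazurTateElementK g Ω p n).map ι)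
    (fun n ↦ (Θ n).map (Subring.inclusion (padicCoeffIntegers_mono hιT₂))) hΘ₂ L₂ hcongr₂ (PowerSeries.C a * Y₀) ev (fun n _ ↦ hread n) U u (fun n _ ↦ hu n) c₁ d₁ hval₁
  -- the content constant moves into `c′ := c₁ · a`
  set a' : padicCoeffIntegers (S ∪ T₂) := Subring.inclusion (padicCoeffIntegers_mono hS) a with ha'
  refine ⟨c₁ * a', d₁, mul_ne_zero hc₁0 ?_, hd₁0, fun n hn ↦ ?_⟩
  · intro h0
    apply ha
    have h1 : ((a' : padicCoeffIntegers (S ∪ T₂)) : PadicAlgCl p) = 0 := by rw [h0, Subring.coe_zero]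
    rw [ha', coe_inclO hS] at h1
    exact Subtype.ext (by simpa using h1)
  have e : iwasawaOToPowerSeries S (↑U⁻¹ * (PowerSeries.C a * Y₀)) = PowerSeries.C (a : PadicAlgCl p) * iwasawaOToPowerSeries S (↑U⁻¹ * Y₀) := by
    rw [mul_left_comm, map_mul, iwasawaOToPowerSeries_C]
  have k := key n hn
  rw [e, ← mul_assoc (PowerSeries.C (c₁ : PadicAlgCl p)), ← map_mul] at k
  have hca : ((c₁ * a' : padicCoeffIntegers (S ∪ T₂)) : PadicAlgCl p) = (c₁ : PadicAlgCl p) * (a : PadicAlgCl p) := by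
    rw [Subring.coe_mul, ha', coe_inclO hS]
  rw [hca]
  exact k

end Summit.BirchSwinnertonDyer.BirchSwinnertonDyer.Theorems.SmallImageRttReciprocity

end
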